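import Summits.Ventures.PercRepro.RankLevelSetStarPlusThreeLine

/-! # RankLevelSetPerElemChain — THE UP-SHADOW CHAIN OF A HYPERPLANE FAMILY IN THE DUAL (night-1 g36; dossier
§48.12; on `RankLevelSetStarPlusThreeLine`)

For a finite matroid `N` (the dual `M✶`), a flat `H ⊆ N.E` of nonloops with `y ∉ cl H` and `insert y H`
spanning, and a set `S`, the HYPERPLANE FAMILY at level `i` is
the set `{X ⊆ H : #X = i, S ∪ X spans, insert y (H ∖ X) spans}` (the members of a circuit class of
the per-element inequality (★★), and its targets, are its levels `j − s` and `h − j`, see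
`RankLevelSetPerElemFour`). Its profile `f` satisfies the UP-SHADOW STEP
`(h − i − (ρ − 1)) · f i ≤ (i + 1) · f (i + 1)` whenever `rk H ≤ ρ < h − i` (**`absorbFam_step`**): a member `X`
at level `i` gains every `t ∈ H ∖ X` that is not a coloop of `N | (H ∖ X)`, and there are at most `ρ − 1` coloops in
a set of nonloops of rank `≤ ρ` with more than `ρ` elements (**`ncard_coloops_add_one_le`**: the coloops are
independent and skew to the rest, which has rank `≥ 1`); each member at level `i + 1` has at most `i + 1` such
subsets. TELESCOPING the steps from level `a` to level `a + m` (**`le_of_chain`**, a statement about sequences of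
naturals): `f a · ∏_{t<m} (c − t) ≤ f (a + m) · ∏_{t<m} (a + m − t)`, and the left product is the larger one as
soon as `a + m ≤ c`, so `f a ≤ f (a + m)`. Every declaration has a docstring; imports: the cell's own modules and
Mathlib only. Axioms: standard. -/

namespace PercRepro

open Set Matroid

variable {α : Type}

/-! ## The coloops of a set of nonloops -/

/-- Adding elements outside the closure of the rest one by one: `eRk (Y' ∪ D) = eRk Y' + #D` for a finite `D`
whose every element `d` is outside `cl (Y' ∪ (D ∖ {d}))`. -/
lemma eRk_union_eq_add_encard_of_forall_notMem_closure {N : Matroid α} {Y' : Set α}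
    (D : Finset α) (hD : ↑D ⊆ N.E) (hsk : ∀ d ∈ D, d ∉ N.closure (Y' ∪ (↑D \ {d}))) :
    N.eRk (Y' ∪ ↑D) = N.eRk Y' + (D.card : ℕ∞) := by
  classical
  induction D using Finset.induction_on with
  | empty => simp
  | insert d D hdD ih =>
    have hDE : ↑D ⊆ N.E := fun x hx => hD (Finset.mem_coe.mpr (Finset.mem_insert_of_mem hx))
    have hdE : d ∈ N.E := hD (Finset.mem_coe.mpr (Finset.mem_insert_self d D))
    have hsk' : ∀ d' ∈ D, d' ∉ N.closure (Y' ∪ (↑D \ {d'})) := by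
      intro d' hd' h
      apply hsk d' (Finset.mem_insert_of_mem hd')
      refine N.closure_subset_closure ?_ h
      intro x hx
      rcases hx with hx | hx
      · exact Or.inl hx
      · exact Or.inr ⟨by rw [Finset.coe_insert]; exact Set.mem_insert_of_mem d hx.1, hx.2⟩
    have hd : d ∉ N.closure (Y' ∪ ↑D) := by
      intro h
      apply hsk d (Finset.mem_insert_self d D)
      refine N.closure_subset_closure ?_ h
      intro x hx
      rcases hx with hx | hx
      · exact Or.inl hx
      · refine Or.inr ⟨by rw [Finset.coe_insert]; exact Set.mem_insert_of_mem d hx, ?_⟩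
        rw [Set.mem_singleton_iff]; rintro rfl; exact hdD hx
    rw [Finset.coe_insert, Set.union_insert, Matroid.eRk_insert_eq_add_one ⟨hdE, hd⟩, ih hDE hsk',
      Finset.card_insert_of_notMem hdD]
    push_cast
    ring

/-- **A set `Y` of nonloops with more elements than its rank `≤ ρ` has at most `ρ − 1` coloops** (elements
`t ∈ Y` with `t ∉ cl (Y ∖ {t})`): the coloops are skew to the rest, which is nonempty of rank `≥ 1`. -/
lemma ncard_coloops_add_one_le {N : Matroid α} [N.Finite] {Y : Set α} (hYE : Y ⊆ N.E)
    (hnl : ∀ e ∈ Y, N.IsNonloop e) {ρ : ℕ} (hρ : N.eRk Y ≤ ρ) (hY : ρ < Y.ncard) :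
    {t ∈ Y | t ∉ N.closure (Y \ {t})}.ncard + 1 ≤ ρ := by
  classical
  set C := {t ∈ Y | t ∉ N.closure (Y \ {t})} with hC
  have hYfin : Y.Finite := N.ground_finite.subset hYE
  have hCY : C ⊆ Y := fun t ht => ht.1
  have hCfin : C.Finite := hYfin.subset hCY
  set Y' := Y \ C
  have hsplit : Y = Y' ∪ ↑hCfin.toFinset := by
    rw [hCfin.coe_toFinset, Set.sdiff_union_of_subset hCY]
  have hsk : ∀ d ∈ hCfin.toFinset, d ∉ N.closure (Y' ∪ (↑hCfin.toFinset \ {d})) := by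
    intro d hd
    rw [hCfin.mem_toFinset] at hd
    intro h
    apply hd.2
    refine N.closure_subset_closure ?_ h
    rw [hCfin.coe_toFinset]
    intro x hx
    rcases hx with hx | hx
    · exact ⟨hx.1, fun h => hx.2 (by rw [Set.mem_singleton_iff] at h; rw [h]; exact hd)⟩
    · exact ⟨hCY hx.1, hx.2⟩
  have hrk : N.eRk Y = N.eRk Y' + (hCfin.toFinset.card : ℕ∞) := by
    rw [hsplit] at hρ ⊢
    exact eRk_union_eq_add_encard_of_forall_notMem_closure hCfin.toFinset
      (by rw [hCfin.coe_toFinset]; exact hCY.trans hYE) hsk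
  have hCcard : hCfin.toFinset.card = C.ncard := (Set.ncard_eq_toFinset_card C hCfin).symm
  -- `Y'` is nonempty: `#C ≤ eRk Y ≤ ρ < #Y`
  have hCle : (C.ncard : ℕ∞) ≤ ρ := by
    rw [← hCcard]
    calc (hCfin.toFinset.card : ℕ∞) ≤ N.eRk Y' + (hCfin.toFinset.card : ℕ∞) := le_add_self
      _ = N.eRk Y := hrk.symm
      _ ≤ ρ := hρ
  have hCle' : C.ncard ≤ ρ := by exact_mod_cast hCle
  obtain ⟨u, hu⟩ : Y'.Nonempty := by
    rw [← Set.ncard_pos (hYfin.subset Set.sdiff_subset), Set.ncard_sdiff hCY hCfin]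
    omega
  have h1 : (1 : ℕ∞) ≤ N.eRk Y' := by
    rw [← (hnl u hu.1).eRk_eq]
    exact N.eRk_mono (Set.singleton_subset_iff.mpr hu)
  have h2 : ((C.ncard + 1 : ℕ) : ℕ∞) ≤ ρ := by
    calc ((C.ncard + 1 : ℕ) : ℕ∞) = (hCfin.toFinset.card : ℕ∞) + 1 := by rw [hCcard]; push_cast; ring
      _ ≤ (hCfin.toFinset.card : ℕ∞) + N.eRk Y' := by gcongr
      _ = N.eRk Y := by rw [hrk, add_comm]
      _ ≤ ρ := hρ
  exact_mod_cast h2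

/-! ## The hyperplane family and its up-shadow step -/

/-- **The hyperplane family at level `i`** — written out as
`{X | X ⊆ H ∧ X.ncard = i ∧ N.Spanning (S ∪ X) ∧ N.Spanning (insert y (H ∖ X))}` throughout — is finite. -/
lemma absorbFam_finite {N : Matroid α} [N.Finite] {H S : Set α} (hH : H ⊆ N.E) (y : α) (i : ℕ) :
    {X | X ⊆ H ∧ X.ncard = i ∧ N.Spanning (S ∪ X) ∧ N.Spanning (insert y (H \ X))}.Finite :=
  (N.ground_finite.subset hH).finite_subsets.subset (fun _ hX => hX.1)

/-- **THE UP-SHADOW STEP**: for `H ⊆ N.E` of nonloops with `rk H ≤ ρ`, `y ∉ cl H`, `insert y H` spanning, and a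
level `i` with `i + ρ < #H`: `(#H − i − (ρ − 1)) · f i ≤ (i + 1) · f (i + 1)`. -/
theorem absorbFam_step {N : Matroid α} [N.Finite] {H S : Set α} {y : α} (hHE : H ⊆ N.E) (hSE : S ⊆ N.E)
    (hyE : y ∈ N.E) (hyH : y ∉ N.closure H) (hHy : N.Spanning (insert y H)) (hnl : ∀ e ∈ H, N.IsNonloop e)
    {ρ : ℕ} (hρ : N.eRk H ≤ ρ) (hρ1 : 1 ≤ ρ) {i : ℕ} (hi : i + ρ < H.ncard) :
    (H.ncard - i - (ρ - 1)) *
        {X | X ⊆ H ∧ X.ncard = i ∧ N.Spanning (S ∪ X) ∧ N.Spanning (insert y (H \ X))}.ncard ≤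
      (i + 1) * {X | X ⊆ H ∧ X.ncard = i + 1 ∧ N.Spanning (S ∪ X) ∧ N.Spanning (insert y (H \ X))}.ncard := by
  classical
  have hHfin : H.Finite := N.ground_finite.subset hHE
  have hAfin := absorbFam_finite (S := S) hHE y i
  have hBfin := absorbFam_finite (S := S) hHE y (i + 1)
  have hiff : ∀ X ⊆ H, (N.Spanning (insert y X) ↔ N.closure X = N.closure H) :=
    fun X hX => spanning_insert_iff_closure_eq hHE hyE hyH hHy hX
  -- the incidences `(X, X')` with `X ⊆ X'`
  set I : Finset (Set α × Set α) := (hAfin.toFinset ×ˢ hBfin.toFinset).filter (fun p => p.1 ⊆ p.2) with hI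
  -- LOWER BOUND: every member at level `i` has at least `#H − i − (ρ − 1)` up-neighbours
  have hlow : (H.ncard - i - (ρ - 1)) * hAfin.toFinset.card ≤ I.card := by
    refine Finset.mul_card_image_le_card_of_maps_to (f := Prod.fst) ?_ _ ?_
    · intro p hp
      rw [hI, Finset.mem_filter, Finset.mem_product] at hp
      exact hp.1.1
    · intro X hX
      have hXA := hAfin.mem_toFinset.mp hX
      obtain ⟨hXH, hXi, hXs, hXy⟩ := hXA
      have hXfin : X.Finite := hHfin.subset hXH
      set Y := H \ X with hY
      have hYE : Y ⊆ N.E := Set.sdiff_subset.trans hHE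
      have hYfin : Y.Finite := hHfin.subset Set.sdiff_subset
      have hYcard : Y.ncard = H.ncard - i := by rw [hY, Set.ncard_sdiff hXH hXfin, hXi]
      have hYcl : N.closure Y = N.closure H := (hiff Y Set.sdiff_subset).mp hXy
      have hYρ : N.eRk Y ≤ ρ := (N.eRk_mono Set.sdiff_subset).trans hρ
      have hcol := ncard_coloops_add_one_le hYE (fun e he => hnl e he.1) hYρ (by omega)
      -- the non-coloops of `Y` give up-neighbours `insert t X`
      have hmaps : ∀ t ∈ Y \ {t ∈ Y | t ∉ N.closure (Y \ {t})},
          (X, insert t X) ∈ I.filter (fun p => p.1 = X) := by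
        intro t ht
        have htY : t ∈ Y := ht.1
        have htcl : t ∈ N.closure (Y \ {t}) := by
          by_contra h
          exact ht.2 ⟨htY, h⟩
        rw [Finset.mem_filter, hI, Finset.mem_filter, Finset.mem_product]
        refine ⟨⟨⟨hX, ?_⟩, Set.subset_insert t X⟩, rfl⟩
        rw [hBfin.mem_toFinset]
        refine ⟨Set.insert_subset htY.1 hXH, ?_, ?_, ?_⟩
        · rw [Set.ncard_insert_of_notMem htY.2 hXfin, hXi]
        · exact hXs.superset (Set.union_subset_union_right S (Set.subset_insert t X))
            (Set.union_subset hSE (Set.insert_subset (hHE htY.1) (hXH.trans hHE)))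
        · have heq : H \ insert t X = Y \ {t} := by
            ext x
            simp only [hY, Set.mem_sdiff, Set.mem_insert_iff, Set.mem_singleton_iff, not_or]
            tauto
          rw [heq, hiff _ (Set.sdiff_subset.trans Set.sdiff_subset)]
          rw [← hYcl]
          refine subset_antisymm (N.closure_subset_closure Set.sdiff_subset) ?_
          refine Matroid.closure_subset_closure_of_subset_closure ?_
          intro x hx
          by_cases hxt : x = t
          · rw [hxt]; exact htcl
          · exact N.subset_closure _ (Set.sdiff_subset.trans hYE) ⟨hx, by simpa using hxt⟩
      have hinj : Set.InjOn (fun t => (X, insert t X)) (Y \ {t ∈ Y | t ∉ N.closure (Y \ {t})}) := by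
        intro t₁ ht₁ t₂ ht₂ heq
        have h : insert t₁ X = insert t₂ X := congrArg Prod.snd heq
        have : t₁ ∈ insert t₂ X := h ▸ Set.mem_insert t₁ X
        rcases this with h' | h'
        · exact h'
        · exact absurd h' ht₁.1.2
      have hcard1 : (Y \ {t ∈ Y | t ∉ N.closure (Y \ {t})}).ncard = Y.ncard - {t ∈ Y | t ∉ N.closure (Y \ {t})}.ncard :=
        Set.ncard_sdiff (fun t ht => ht.1) (hYfin.subset (fun t ht => ht.1))
      calc H.ncard - i - (ρ - 1) ≤ (Y \ {t ∈ Y | t ∉ N.closure (Y \ {t})}).ncard := by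
            rw [hcard1, hYcard]; omega
        _ = ((fun t => (X, insert t X)) '' (Y \ {t ∈ Y | t ∉ N.closure (Y \ {t})})).ncard :=
            hinj.ncard_image.symm
        _ ≤ (I.filter (fun p => p.1 = X)).card := by
            rw [← Set.ncard_coe_finset]
            refine Set.ncard_le_ncard ?_ (Finset.finite_toSet _)
            rintro p ⟨t, ht, rfl⟩
            exact hmaps t ht
  -- UPPER BOUND: every member at level `i + 1` has at most `i + 1` down-neighbours
  have hup : I.card ≤ (i + 1) * hBfin.toFinset.card := by
    refine Finset.card_le_mul_card_image_of_maps_to (f := Prod.snd) ?_ _ ?_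
    · intro p hp
      rw [hI, Finset.mem_filter, Finset.mem_product] at hp
      exact hp.1.2
    · intro X' hX'
      have hX'B := hBfin.mem_toFinset.mp hX'
      have hX'fin : X'.Finite := hHfin.subset hX'B.1
      -- the fibre injects into `X'` by `X ↦ the element of X' ∖ X`
      have hex : ∀ p ∈ I.filter (fun p => p.2 = X'), ∃ t ∈ X', p.1 = X' \ {t} := by
        intro p hp
        rw [Finset.mem_filter, hI, Finset.mem_filter, Finset.mem_product] at hp
        obtain ⟨⟨⟨hpA, -⟩, hsub⟩, hp2⟩ := hp
        rw [hp2] at hsub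
        have hpA' := hAfin.mem_toFinset.mp hpA
        have h1 : (X' \ p.1).ncard = 1 := by
          rw [Set.ncard_sdiff hsub (hHfin.subset hpA'.1), hX'B.2.1, hpA'.2.1]; omega
        obtain ⟨t, ht⟩ := Set.ncard_eq_one.mp h1
        have htX' : t ∈ X' \ p.1 := by rw [ht]; exact Set.mem_singleton t
        refine ⟨t, htX'.1, ?_⟩
        ext x
        constructor
        · intro hx
          exact ⟨hsub hx, fun h => htX'.2 (by rw [Set.mem_singleton_iff] at h; rw [← h]; exact hx)⟩
        · intro hx
          by_contra hxp
          have : x ∈ X' \ p.1 := ⟨hx.1, hxp⟩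
          rw [ht, Set.mem_singleton_iff] at this
          exact hx.2 (by rw [this]; exact Set.mem_singleton t)
      choose g hg using hex
      set g' : Set α × Set α → α := fun p => if h : p ∈ I.filter (fun p => p.2 = X') then g p h else y with hg'
      have hg'eq : ∀ p (hp : p ∈ I.filter (fun p => p.2 = X')), g' p = g p hp := by
        intro p hp
        simp only [hg', dif_pos hp]
      calc (I.filter (fun p => p.2 = X')).card ≤ hX'fin.toFinset.card := by
            refine Finset.card_le_card_of_injOn g' ?_ ?_
            · intro p hp
              rw [Finset.mem_coe] at hp
              rw [Finset.mem_coe, hX'fin.mem_toFinset, hg'eq p hp]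
              exact (hg p hp).1
            · intro p hp q hq heq
              rw [Finset.mem_coe] at hp hq
              rw [hg'eq p hp, hg'eq q hq] at heq
              have hp' := Finset.mem_filter.mp hp
              have hq' := Finset.mem_filter.mp hq
              refine Prod.ext ?_ (hp'.2.trans hq'.2.symm)
              rw [(hg p hp).2, (hg q hq).2, heq]
        _ = i + 1 := by rw [← Set.ncard_eq_toFinset_card X' hX'fin, hX'B.2.1]
  rw [Set.ncard_eq_toFinset_card _ hAfin, Set.ncard_eq_toFinset_card _ hBfin]
  exact hlow.trans hup

/-! ## Telescoping -/

/-- **The telescoped chain**: if `(c − t) · f (a + t) ≤ (a + t + 1) · f (a + t + 1)` for all `t < m`, then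
`f a · ∏_{t<m} (c − t) ≤ f (a + m) · ∏_{t<m} (a + m − t)`. -/
lemma chain_prod (f : ℕ → ℕ) (a c : ℕ) : ∀ m : ℕ,
    (∀ t, t < m → (c - t) * f (a + t) ≤ (a + t + 1) * f (a + t + 1)) →
    f a * ∏ t ∈ Finset.range m, (c - t) ≤ f (a + m) * ∏ t ∈ Finset.range m, (a + m - t) := by
  intro m
  induction m with
  | zero => intro _; simp
  | succ m ih =>
    intro hstep
    have ih' := ih (fun t ht => hstep t (by omega))
    have hm := hstep m (by omega)
    rw [Finset.prod_range_succ, Finset.prod_range_succ']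
    have e1 : ∏ t ∈ Finset.range m, (a + (m + 1) - (t + 1)) = ∏ t ∈ Finset.range m, (a + m - t) :=
      Finset.prod_congr rfl (fun t _ => by omega)
    rw [e1, show a + (m + 1) - 0 = a + m + 1 by omega]
    calc f a * ((∏ t ∈ Finset.range m, (c - t)) * (c - m))
        = (f a * ∏ t ∈ Finset.range m, (c - t)) * (c - m) := by ring
      _ ≤ (f (a + m) * ∏ t ∈ Finset.range m, (a + m - t)) * (c - m) := Nat.mul_le_mul_right _ ih'
      _ = ((c - m) * f (a + m)) * ∏ t ∈ Finset.range m, (a + m - t) := by ring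
      _ ≤ ((a + m + 1) * f (a + m + 1)) * ∏ t ∈ Finset.range m, (a + m - t) := Nat.mul_le_mul_right _ hm
      _ = f (a + (m + 1)) * ((∏ t ∈ Finset.range m, (a + m - t)) * (a + m + 1)) := by ring

/-- **The chain inequality**: with `a + m ≤ c`, the steps give `f a ≤ f (a + m)`. -/
lemma le_of_chain (f : ℕ → ℕ) {a c m : ℕ} (hc : a + m ≤ c)
    (hstep : ∀ t, t < m → (c - t) * f (a + t) ≤ (a + t + 1) * f (a + t + 1)) : f a ≤ f (a + m) := by
  have h := chain_prod f a c m hstep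
  have hpos : 0 < ∏ t ∈ Finset.range m, (a + m - t) :=
    Finset.prod_pos (fun t ht => by have := Finset.mem_range.mp ht; omega)
  have hle : ∏ t ∈ Finset.range m, (a + m - t) ≤ ∏ t ∈ Finset.range m, (c - t) :=
    Finset.prod_le_prod' (fun t ht => by have := Finset.mem_range.mp ht; omega)
  have h2 : f a * ∏ t ∈ Finset.range m, (a + m - t) ≤ f (a + m) * ∏ t ∈ Finset.range m, (a + m - t) :=
    (Nat.mul_le_mul_left _ hle).trans h
  exact Nat.le_of_mul_le_mul_right h2 hpos

end PercRepro
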